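import Summits.QuantumFields.YangMills.Theorems.SwapVirialDeficitNearFlatRelations
import Summits.QuantumFields.YangMills.Theorems.SwapVirialDeficitNearFlatChart
import Summits.QuantumFields.YangMills.Theorems.SwapVirialDeficitNearFlatHubComm
import HarnessLib

/-!
# NEAR-FLAT PROJECTION OVER A BULK HUB: `dist(q, Flat) ≤ (60L³√F/√2)·(1 + 1/|re ĉ|)·(1 + 1/‖im ĉ‖)` — Lipschitz in `√F` whenever the hub is off the apex AND off the end
# (free-hands support of ⟨stmt-QuantumFields-24197⟩ `SwapVirialDeficit.SwapGluedStiffness`; LEAD g98/g99 plan of record memo7 §C(c) «matching on ω-patches»: the COMPLETE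
# projection lemma on every patch whose hub angle ψ satisfies `τ ≤ ψ ≤ π/2 − τ` (then `|re ĉ|, ‖im ĉ‖ ≥ sin τ`); the end patches need LEAD g99's σ-word∕B branch)

Assembly of ✓`exists_flat_near_of_heavy` (heavy element = the hub `c = Ĉ₃`), ✓`relations_le_of_chartDeficit` (`M := 60L³√F/√2` bounds every relation) and ✓`norm_comm_hub_le`
(`‖[c, C₀]‖, ‖[c, C₁]‖ ≤ M/|re c|` from two σ-residuals):
* ★★★ `exists_flat_near_bulk (q) (hre : Ĉ₃.re ≠ 0) (him : Ĉ₃.im ≠ 0)`: `∃ q♭, chartDeficit L 0 1 q♭ = 0 ∧ (∀ i, q♭.2 i = 1) ∧ ∀ k, ‖Ĉ_k − su2Quat (q♭.1 k)‖ ≤ M·(1 + 1/|re Ĉ₃|)·(1 + 1/‖im Ĉ₃‖)`.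

HONEST LABEL: assembly of landed lemmas; stubs of ➎, ⟨24197⟩ ∕ ⟨24194⟩ ∕ ⟨24497⟩ OPEN; own crux ⟨22884⟩ OPEN (blocked-on ⟨19935⟩); the Yang–Mills mass gap is NOT proved; no summit is
proved by a line.  THEOREMS ONLY (0 `def`, 0 `sorry`), standard axioms.  Width seat ym-line-sfw-p2-w3 g66 (cell ym-idea-1, free hands), `--supports stmt-QuantumFields-24197`.
References: [cite: Luscher1983, §2]; [folklore].
-/

set_option autoImplicit false

noncomputable section

open Quaternion
open scoped Quaternion
open Literature.MathematicalPhysics.QuantumFieldTheory hiding SU2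
open Literature.MathematicalPhysics.QuantumLattice

namespace Summit.QuantumFields.YangMills.Theorems.SwapVirialDeficit.NearFlat

open Summit.QuantumFields.YangMills.Theorems.FemtoTransferGap
open Summit.QuantumFields.YangMills.Theorems.FemtoTransferGap.TT
open Summit.QuantumFields.YangMills.Theorems.VirialFluxGap.RingDeficit
open Summit.QuantumFields.YangMills.Theorems.SwapVirialDeficit.SwapRing
open Summit.QuantumFields.YangMills.Theorems.SwapVirialDeficit.BlowUpRing

variable {L : ℕ} [NeZero L]

set_option maxHeartbeats 800000 in
/-- ★★★ **NEAR-FLAT PROJECTION OVER A BULK HUB** (principal sector): if the hub `Ĉ₃ = su2Quat (q.1 3)` has `re ≠ 0` and `im ≠ 0`, there is an exactly flat `q♭` (followers `1`) with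
`‖Ĉ_k − su2Quat (q♭.1 k)‖ ≤ (60L³√F/√2)·(1 + 1/|re Ĉ₃|)·(1 + 1/‖im Ĉ₃‖)` for every leader `k`. [cite: Luscher1983, §2] -/
theorem exists_flat_near_bulk (q : (Fin 4 → SU2) × (Fol L → SU2)) (hre : (su2Quat (q.1 3)).re ≠ 0) (him : (su2Quat (q.1 3)).im ≠ 0) :
    ∃ qf : (Fin 4 → SU2) × (Fol L → SU2), chartDeficit L (fun _ => false) (fun _ => 1) qf = 0 ∧ (∀ i, qf.2 i = 1) ∧
      ∀ k, ‖su2Quat (q.1 k) - su2Quat (qf.1 k)‖ ≤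
        (60 * (L : ℝ) ^ 3 * Real.sqrt (chartDeficit L (fun _ => false) (fun _ => 1) q) / Real.sqrt 2) *
          (1 + 1 / |(su2Quat (q.1 3)).re|) * (1 + 1 / ‖(su2Quat (q.1 3)).im‖) := by
  obtain ⟨qf, hflat, hfol, hdist, hdist1⟩ := exists_flat_near_of_heavy (L := L) q 3 him
  obtain ⟨hc, hσ, -⟩ := relations_le_of_chartDeficit (L := L) q
  refine ⟨qf, hflat, hfol, fun k => ?_⟩
  -- names
  have hM0 : 0 ≤ 60 * (L : ℝ) ^ 3 * Real.sqrt (chartDeficit L (fun _ => false) (fun _ => 1) q) / Real.sqrt 2 :=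
    div_nonneg (mul_nonneg (by positivity) (Real.sqrt_nonneg _)) (Real.sqrt_nonneg _)
  obtain ⟨M, hM⟩ : ∃ M : ℝ, M = 60 * (L : ℝ) ^ 3 * Real.sqrt (chartDeficit L (fun _ => false) (fun _ => 1) q) / Real.sqrt 2 := ⟨_, rfl⟩
  rw [← hM] at hc hσ hM0 ⊢
  rw [show (Fin.last 3 : Fin 4) = 3 from rfl] at hσ
  obtain ⟨c, hcdef⟩ : ∃ c : ℍ, c = su2Quat (q.1 3) := ⟨_, rfl⟩
  rw [← hcdef] at hσ hdist hdist1 hre him ⊢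
  have hr0 : 0 < |c.re| := abs_pos.2 hre
  have hi0 : 0 < ‖c.im‖ := norm_pos_iff.2 him
  have hcu : ‖c‖ = 1 := by rw [hcdef]; exact norm_su2Quat _
  -- the σ-residuals in quaternion norm
  have hσ0 : ‖c * su2Quat (q.1 1) - su2Quat (q.1 0) * c‖ ≤ M := by
    have h := hσ 0; rw [Equiv.swap_apply_left] at h; exact h
  have hσ1 : ‖c * su2Quat (q.1 0) - su2Quat (q.1 1) * c‖ ≤ M := by
    have h := hσ 1; rw [Equiv.swap_apply_right] at h; exact h
  have hσ2 : ‖c * su2Quat (q.1 2) - su2Quat (q.1 2) * c‖ ≤ M := by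
    have h := hσ 2; rw [Equiv.swap_apply_of_ne_of_ne (by decide) (by decide)] at h; exact h
  -- the hub commutators through `norm_comm_hub_le`
  have hc0 : ‖c * su2Quat (q.1 0) - su2Quat (q.1 0) * c‖ ≤ M / |c.re| := by
    have h := norm_comm_hub_le hcu (su2Quat (q.1 0)) (su2Quat (q.1 1))
    rw [le_div_iff₀ hr0]
    nlinarith [h, hσ0, hσ1]
  have hc1 : ‖c * su2Quat (q.1 1) - su2Quat (q.1 1) * c‖ ≤ M / |c.re| := by
    have h := norm_comm_hub_le hcu (su2Quat (q.1 1)) (su2Quat (q.1 0))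
    rw [le_div_iff₀ hr0]
    nlinarith [h, hσ0, hσ1]
  -- the target bound dominates each case
  have hbig : ∀ x : ℝ, x ≤ M + M / |c.re| → x / ‖c.im‖ ≤ M * (1 + 1 / |c.re|) * (1 + 1 / ‖c.im‖) := by
    intro x hx
    have e : M + M / |c.re| = M * (1 + 1 / |c.re|) := by ring
    have h1 : x / ‖c.im‖ ≤ M * (1 + 1 / |c.re|) / ‖c.im‖ := div_le_div_of_nonneg_right (by linarith) hi0.le
    have h2 : M * (1 + 1 / |c.re|) / ‖c.im‖ ≤ M * (1 + 1 / |c.re|) * (1 + 1 / ‖c.im‖) := by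
      have hP : 0 ≤ M * (1 + 1 / |c.re|) := mul_nonneg hM0 (by positivity)
      rw [div_eq_mul_one_div]
      exact mul_le_mul_of_nonneg_left (by linarith [show 0 ≤ 1 / ‖c.im‖ from by positivity]) hP
    linarith
  by_cases hk : k = 1
  · subst hk
    refine hdist1.trans ?_
    -- `σ₀ + ‖[Ĉ₀, c]‖ + ‖[c, Ĉ₀]‖/‖im c‖ ≤ M + M/|re c| + (M/|re c|)/‖im c‖`
    have h01 : ‖su2Quat (q.1 0) * c - c * su2Quat (q.1 0)‖ ≤ M / |c.re| := by rw [norm_sub_rev]; exact hc0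
    have h3 : ‖c * su2Quat (q.1 0) - su2Quat (q.1 0) * c‖ / ‖c.im‖ ≤ M / |c.re| / ‖c.im‖ := div_le_div_of_nonneg_right hc0 hi0.le
    have hgoal : M + M / |c.re| + M / |c.re| / ‖c.im‖ ≤ M * (1 + 1 / |c.re|) * (1 + 1 / ‖c.im‖) := by
      have e : M * (1 + 1 / |c.re|) * (1 + 1 / ‖c.im‖) = M + M / |c.re| + M / ‖c.im‖ + M / |c.re| / ‖c.im‖ := by ring
      rw [e]; linarith [show 0 ≤ M / ‖c.im‖ from div_nonneg hM0 (norm_nonneg _)]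
    linarith [hσ0, h01, h3]
  · refine (hdist k hk).trans (hbig _ ?_)
    fin_cases k
    · exact hc0.trans (by linarith)
    · exact absurd rfl hk
    · exact hσ2.trans (by linarith [show 0 ≤ M / |c.re| from div_nonneg hM0 (abs_nonneg _)])
    · show ‖c * su2Quat (q.1 3) - su2Quat (q.1 3) * c‖ ≤ M + M / |c.re|
      rw [← hcdef, sub_self, norm_zero]; exact add_nonneg hM0 (div_nonneg hM0 (abs_nonneg _))

end Summit.QuantumFields.YangMills.Theorems.SwapVirialDeficit.NearFlat

end
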